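import Summits.CriticalPhenomena.CardyFormulaZ2.Theorems.CardyFlipRussoSquareFromVoronoiHubProductLegDefs
import Summits.CriticalPhenomena.CardyFormulaZ2.Theorems.CardyFlipRussoSquareFromVoronoiHubFaceDiagonal
import Summits.CriticalPhenomena.CardyFormulaZ2.Theorems.CardyFlipRussoSquareFromVoronoiHubCrossingDelaunay
import Summits.CriticalPhenomena.CardyFormulaZ2.Theorems.CardyFlipRussoSquareFromVoronoiHubFaceDiagonalsCross
import Summits.CriticalPhenomena.CardyFormulaZ2.Theorems.CardyFlipRussoSquareFromVoronoiHubConcyclicNull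
import Summits.CriticalPhenomena.CardyFormulaZ2.Theorems.CardyFlipRussoSquareFromVoronoiHubDiagonalSymmetry
import HarnessLib

/-!
# The Delaunay-diagonal field of the disc-jittered square lattice: a.s. exactly one diagonal per face, fair
# (line `SketchIdeator5R2`, crux `SquareFromVoronoiHub`, stmt-CriticalPhenomena-6434, route `CardyFlipRusso`)

Assembly of the endpoint geometry of the product leg (lead `prover-line-stmt-CriticalPhenomena-6434-a1-0`,
2026-08-17).  Under the i.i.d. jitter law `Measure.infinitePi (fun _ ↦ jitterLaw)` (uniform on the closed
disc of radius `1/20`):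

* `ae_forall_norm_jitter_le` — almost surely every jitter has norm `≤ 1/20`;
* `stub_endpointField` (registered stub of the line) — for every face, almost surely EXACTLY ONE of its two
  diagonals is a Delaunay pair of the jittered lattice: at least one by `stub_faceDiagonal` (p138482), at
  most one because both would force a concyclic face (`stub_faceDiagonalsCross` p139305 +
  `stub_crossingDelaunay_cospherical` p137979), a null event (`stub_concyclicFace_null` p139705);
* `measure_diagSWNE_eq_measure_diagSENW`, `one_le_measure_diagSWNE_add` and
  `one_le_two_mul_measure_diagSWNE` — the two orientations are equally likely
  (`stub_diagonal_reflection_symm` p139457) and together exhaust a full-measure set, so each has (outer)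
  probability `≥ 1/2`: the Delaunay-diagonal orientation field at the endpoint `t = 1` of the product
  leg is a FAIR random diagonal field on `ℤ²` — the object on which leg S of the line starts.

Sources: card `Cruxes/SquareFromVoronoiHub/Ideas/one-product-leg.md`; Boissonnat–Yvinec,
*Algorithmic Geometry* (1998), Thm 17.3.4 (empty-ball rule); Bollobás–Riordan, *Percolation* (2006),
Ch. 8 §8.1.
-/

noncomputable section

open scoped Topology MeasureTheory ENNReal
open Filter Set MeasureTheory Metric
open Literature.Probability.LatticeModels (IsDelaunayPair)

namespace Summit.CriticalPhenomena.CardyFormulaZ2.Cruxes.SquareFromVoronoiHub.ProductLeg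

/-- A single jitter lies in the closed disc of radius `jitterRadius` with `jitterLaw`-probability one:
the complement of the disc is `jitterLaw`-null. [folklore] -/
theorem jitterLaw_compl_closedBall : jitterLaw (closedBall (0 : ℂ) jitterRadius)ᶜ = 0 := by
  unfold jitterLaw
  rw [ProbabilityTheory.cond_apply measurableSet_closedBall, Set.inter_compl_self, measure_empty,
    mul_zero]

/-- Almost surely (for the i.i.d. jitter law) EVERY jitter has norm at most `1/20`. [folklore] -/
theorem ae_forall_norm_jitter_le :
    ∀ᵐ ξ ∂(Measure.infinitePi (fun _ : ℤ × ℤ => jitterLaw)), ∀ u : ℤ × ℤ, ‖ξ u‖ ≤ 1 / 20 := by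
  rw [ae_all_iff]
  intro u
  have hmp := measurePreserving_eval_infinitePi (fun _ : ℤ × ℤ => jitterLaw) u
  have h0 : Measure.infinitePi (fun _ : ℤ × ℤ => jitterLaw)
      ((Function.eval u) ⁻¹' (closedBall (0 : ℂ) jitterRadius)ᶜ) = 0 := by
    rw [← Measure.map_apply hmp.measurable measurableSet_closedBall.compl, hmp.map_eq]
    exact jitterLaw_compl_closedBall
  rw [ae_iff]
  refine measure_mono_null (fun ξ hξ => ?_) h0
  simp only [mem_setOf_eq, not_le] at hξ
  simp only [mem_preimage, Function.eval, mem_compl_iff, mem_closedBall, dist_zero_right, not_le,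
    jitterRadius]
  exact hξ

/-- **Registered stub `stub_endpointField`: almost surely exactly one Delaunay diagonal per face.**
For every face (lower-left corner `v`) of the disc-jittered square lattice, for almost every jitter
field `ξ`: the SW–NE pair or the SE–NW pair is a Delaunay pair of the jittered point set (at least one
diagonal, `stub_faceDiagonal`), and not both (two crossing Delaunay diagonals force a concyclic face,
`stub_faceDiagonalsCross` + `stub_crossingDelaunay_cospherical`, which is a null event,
`stub_concyclicFace_null`). [cite: BoissonnatYvinec1998, Thm 17.3.4] -/
theorem stub_endpointField :
    ∀ v : ℤ × ℤ, ∀ᵐ ξ ∂(Measure.infinitePi (fun _ : ℤ × ℤ => jitterLaw)),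
      (IsDelaunayPair (Set.range fun u : ℤ × ℤ => sqPos u + ξ u) (sqPos v + ξ v)
          (sqPos (v.1 + 1, v.2 + 1) + ξ (v.1 + 1, v.2 + 1)) ∨
        IsDelaunayPair (Set.range fun u : ℤ × ℤ => sqPos u + ξ u) (sqPos (v.1 + 1, v.2) + ξ (v.1 + 1, v.2))
          (sqPos (v.1, v.2 + 1) + ξ (v.1, v.2 + 1))) ∧
      ¬ (IsDelaunayPair (Set.range fun u : ℤ × ℤ => sqPos u + ξ u) (sqPos v + ξ v)
            (sqPos (v.1 + 1, v.2 + 1) + ξ (v.1 + 1, v.2 + 1)) ∧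
          IsDelaunayPair (Set.range fun u : ℤ × ℤ => sqPos u + ξ u) (sqPos (v.1 + 1, v.2) + ξ (v.1 + 1, v.2))
            (sqPos (v.1, v.2 + 1) + ξ (v.1, v.2 + 1))) := by
  intro v
  have hnc := measure_eq_zero_iff_ae_notMem.1 (stub_concyclicFace_null v)
  filter_upwards [ae_forall_norm_jitter_le, hnc] with ξ hξ hncξ
  have h20 : (0 : ℝ) ≤ 1 / 20 := by norm_num
  refine ⟨?_, ?_⟩
  · exact stub_faceDiagonal (1 / 20) ξ h20 le_rfl hξ v
  · rintro ⟨h1, h2⟩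
    apply hncξ
    obtain ⟨X, hX1, hX2⟩ := stub_faceDiagonalsCross (1 / 20) ξ h20 le_rfl hξ v
    exact stub_crossingDelaunay_cospherical (Set.range fun u : ℤ × ℤ => sqPos u + ξ u)
      (sqPos v + ξ v) (sqPos (v.1 + 1, v.2) + ξ (v.1 + 1, v.2))
      (sqPos (v.1 + 1, v.2 + 1) + ξ (v.1 + 1, v.2 + 1)) (sqPos (v.1, v.2 + 1) + ξ (v.1, v.2 + 1))
      ⟨v, rfl⟩ ⟨(v.1 + 1, v.2), rfl⟩ ⟨(v.1 + 1, v.2 + 1), rfl⟩ ⟨(v.1, v.2 + 1), rfl⟩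
      ⟨X, hX1, hX2⟩ h1 h2

/-- **Fairness, symmetry half**: the SW–NE and the SE–NW Delaunay-diagonal events of a face have the
same probability under the i.i.d. disc jitter law (re-export of `stub_diagonal_reflection_symm`).
[folklore] -/
theorem measure_diagSWNE_eq_measure_diagSENW (v : ℤ × ℤ) :
    Measure.infinitePi (fun _ : ℤ × ℤ => jitterLaw)
        {ξ | IsDelaunayPair (Set.range fun u : ℤ × ℤ => sqPos u + ξ u) (sqPos v + ξ v)
          (sqPos (v.1 + 1, v.2 + 1) + ξ (v.1 + 1, v.2 + 1))} =
      Measure.infinitePi (fun _ : ℤ × ℤ => jitterLaw)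
        {ξ | IsDelaunayPair (Set.range fun u : ℤ × ℤ => sqPos u + ξ u) (sqPos (v.1 + 1, v.2) + ξ (v.1 + 1, v.2))
          (sqPos (v.1, v.2 + 1) + ξ (v.1, v.2 + 1))} :=
  stub_diagonal_reflection_symm v

/-- **Fairness, exhaustion half**: the two diagonal events of a face cover a full-measure set (every
face of a lattice with jitters `≤ 1/20` has a Delaunay diagonal), so their (outer) probabilities sum to
at least one. [folklore] -/
theorem one_le_measure_diagSWNE_add (v : ℤ × ℤ) :
    1 ≤ Measure.infinitePi (fun _ : ℤ × ℤ => jitterLaw)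
        {ξ | IsDelaunayPair (Set.range fun u : ℤ × ℤ => sqPos u + ξ u) (sqPos v + ξ v)
          (sqPos (v.1 + 1, v.2 + 1) + ξ (v.1 + 1, v.2 + 1))} +
      Measure.infinitePi (fun _ : ℤ × ℤ => jitterLaw)
        {ξ | IsDelaunayPair (Set.range fun u : ℤ × ℤ => sqPos u + ξ u) (sqPos (v.1 + 1, v.2) + ξ (v.1 + 1, v.2))
          (sqPos (v.1, v.2 + 1) + ξ (v.1, v.2 + 1))} := by
  set μ := Measure.infinitePi (fun _ : ℤ × ℤ => jitterLaw) with hμ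
  set E₁ := {ξ : ℤ × ℤ → ℂ | IsDelaunayPair (Set.range fun u : ℤ × ℤ => sqPos u + ξ u) (sqPos v + ξ v)
      (sqPos (v.1 + 1, v.2 + 1) + ξ (v.1 + 1, v.2 + 1))}
  set E₂ := {ξ : ℤ × ℤ → ℂ | IsDelaunayPair (Set.range fun u : ℤ × ℤ => sqPos u + ξ u)
      (sqPos (v.1 + 1, v.2) + ξ (v.1 + 1, v.2)) (sqPos (v.1, v.2 + 1) + ξ (v.1, v.2 + 1))}
  set N := {ξ : ℤ × ℤ → ℂ | ¬ ∀ u : ℤ × ℤ, ‖ξ u‖ ≤ 1 / 20}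
  have hN : μ N = 0 := by
    have := ae_forall_norm_jitter_le
    rw [ae_iff] at this
    exact this
  have hcover : (Set.univ : Set (ℤ × ℤ → ℂ)) ⊆ E₁ ∪ E₂ ∪ N := by
    intro ξ _
    by_cases hξ : ∀ u : ℤ × ℤ, ‖ξ u‖ ≤ 1 / 20
    · have h := stub_faceDiagonal (1 / 20) ξ (by norm_num) le_rfl hξ v
      rcases h with h | h
      · exact Or.inl (Or.inl h)
      · exact Or.inl (Or.inr h)
    · exact Or.inr hξ
  calc (1 : ℝ≥0∞) = μ Set.univ := (measure_univ).symm
    _ ≤ μ (E₁ ∪ E₂ ∪ N) := measure_mono hcover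
    _ ≤ μ (E₁ ∪ E₂) + μ N := measure_union_le _ _
    _ ≤ μ E₁ + μ E₂ + μ N := by gcongr; exact measure_union_le _ _
    _ = μ E₁ + μ E₂ := by rw [hN, add_zero]

/-- **Fairness**: each diagonal orientation of a face is a Delaunay pair with (outer) probability at
least `1/2` — `1 ≤ 2 · P[SW–NE is Delaunay]` (and the same for SE–NW by symmetry); with
`stub_endpointField` the two events are a.s. complementary, so the Delaunay-diagonal orientation field
of the jittered lattice is a fair random diagonal field. [folklore] -/
theorem one_le_two_mul_measure_diagSWNE (v : ℤ × ℤ) :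
    1 ≤ 2 * Measure.infinitePi (fun _ : ℤ × ℤ => jitterLaw)
        {ξ | IsDelaunayPair (Set.range fun u : ℤ × ℤ => sqPos u + ξ u) (sqPos v + ξ v)
          (sqPos (v.1 + 1, v.2 + 1) + ξ (v.1 + 1, v.2 + 1))} := by
  have h := one_le_measure_diagSWNE_add v
  rw [← measure_diagSWNE_eq_measure_diagSENW v] at h
  rwa [two_mul]

end Summit.CriticalPhenomena.CardyFormulaZ2.Cruxes.SquareFromVoronoiHub.ProductLeg

end
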